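import Summits.CriticalPhenomena.PercolationContinuityZ3.Theorems.PercNearOneGluingNoHeavyPcintMemUniformTenStructA
import Summits.CriticalPhenomena.PercolationContinuityZ3.Theorems.PercNearOneGluingNoHeavyPcintMemUniformTenStructB
import Summits.CriticalPhenomena.PercolationContinuityZ3.Theorems.PercNearOneGluingNoHeavyPcintMemUniformTenStructC
import Summits.CriticalPhenomena.PercolationContinuityZ3.Theorems.PercNearOneGluingNoHeavyPcintMemUniformTenStructD
import HarnessLib

/-!
# CriticalPhenomena/PercolationContinuityZ3 — Theorems/PercNearOneGluingNoHeavyPcintMemUniformTenStruct.lean: the 6192-row memory-10 list is structurally valid and supported off axis `5`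

Lane prim-pcint, STRUCTURE rule (prim-pcint-2 GEN 19; P20: the memory-10 class automaton is uniform in `d` from base dimension 6).  Assembly of
…TenStructA–D: **`ustruct_u10 : UStructK 10 (rowsOf perm6 u10tab)`** (every recorded successor is `mstep 10` of the row state up to the recorded
symmetry), and **`usupp_u10 : USuppK (rowsOf perm6 u10tab)`** (every row vanishes on axis `5`; fast check `USuppRowsF` in 1024-row ranges).  With
…MemUniformGen(+Bounds) this makes ONE dimension-6 list simulate `mstep 10` on `ℤ^d` for every `d ≥ 6`.

HONEST FRAMING: assembly of kernel checks.  No `sorry`; standard axioms.  Written by prim-pcint-2 gen 19, 2026-08-26.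
-/

namespace Summit.CriticalPhenomena.PercolationContinuityZ3.Theorems.Pcint

open Literature.Probability.Percolation Literature.Probability.LatticeModels

/-- Support check of rows 0–1023. [folklore] -/
theorem supp10_0 : USuppRowsF u10tab 0 1024 = true := by
  decide +kernel

/-- Support check of rows 1024–2047. [folklore] -/
theorem supp10_1024 : USuppRowsF u10tab 1024 1024 = true := by
  decide +kernel

/-- Support check of rows 2048–3071. [folklore] -/
theorem supp10_2048 : USuppRowsF u10tab 2048 1024 = true := by
  decide +kernel

/-- Support check of rows 3072–4095. [folklore] -/
theorem supp10_3072 : USuppRowsF u10tab 3072 1024 = true := by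
  decide +kernel

/-- Support check of rows 4096–5119. [folklore] -/
theorem supp10_4096 : USuppRowsF u10tab 4096 1024 = true := by
  decide +kernel

/-- Support check of rows 5120–6191. [folklore] -/
theorem supp10_5120 : USuppRowsF u10tab 5120 1072 = true := by
  decide +kernel

/-- **Every row of the memory-10 list vanishes on axis `5`.** [folklore] -/
theorem usupp_u10 : USuppK (k := 5) (rowsOf perm6 u10tab) :=
  usuppK_of_chunks perm6 u10tab chunksOK_u10 length_u10 (usuppRowsC_append u10tab (usuppRowsC_append u10tab (usuppRowsC_append u10tab (usuppRowsC_append u10tab (usuppRowsC_append u10tab (usuppRowsC_of_fast u10tab supp10_0) (usuppRowsC_of_fast u10tab supp10_1024)) (usuppRowsC_of_fast u10tab supp10_2048)) (usuppRowsC_of_fast u10tab supp10_3072)) (usuppRowsC_of_fast u10tab supp10_4096)) (usuppRowsC_of_fast u10tab supp10_5120))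

/-- All 6192 rows pass the structural check. [folklore] -/
theorem structRows10 : URowsOKC perm6 u10tab 10 6192 0 6192 :=
  urowsOKC_append perm6 u10tab (urowsOKC_append perm6 u10tab (urowsOKC_append perm6 u10tab structRows10A structRows10B) structRows10C)
    structRows10D

/-- **The memory-10 list `u10tab` is structurally valid** (`UStructK 10`). [folklore] -/
theorem ustruct_u10 : UStructK (k := 5) 10 (rowsOf perm6 u10tab) :=
  ustructK_of_chunks perm6 u10tab chunksOK_u10 length_u10 (by norm_num) sstC_u10_zero (urowOKC_of_range perm6 u10tab structRows10)

end Summit.CriticalPhenomena.PercolationContinuityZ3.Theorems.Pcint
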